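import Mathlib
import Literature.NumberTheory.LFunctions.Zhang2022.Section10cProfiles
import HarnessLib

/-!
# Zhang (2022) §10c: `Z22:§10.u055 (ii)` — the low range of `S_j(𝐚₁₂,𝐚₁₄)` passes from its `n`-sum
# to the printed `x`-integral, `Typed.Sec10C.Low1214X c′`, PROVED OUTRIGHT

Topic `Literature/NumberTheory/LFunctions/Zhang2022` (Landau–Siegel audit tree; verdict-neutral).
Y. Zhang, *Discrete mean estimates and the Landau–Siegel zero*, arXiv:2211.02515v1 (2022)
[Zhang2022LandauSiegel], §10 p. 60 (tex L3081, second line): "`… = (𝔞β_{j+1}β_{j+2}/500)∫₁^{P^{0.496}}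
(ῑ₃𝔣_{j6}(P^{0.498}/x)/0.498 + ῑ₄𝔣_{j7}(P^{0.5}/x)/0.5)dx/x + o(α)`" — **an unrefereed manuscript under
adjudication; this file proves ONE of its displayed steps from tree theorems and asserts nothing about
its Theorems 1–2.** ZHANG-L discharge lane (WP10, seat zl-w10-p5; recipe = sz-d34's HANDOFF of record
2026-08-26T02:12Z); closes the §10c node `Low1214X` feeding the v19 leaf `Typed.Sec10C.Gather1214` via
`gather1214_of_ranges` (with the tree's `low1214Int_holds`, `mid1214Int_holds`, `top1214Int_holds`,
leaving the three "first lines" `Low1214Eval`, `Mid1214Eval`, `Top1214Eval` of that leaf open).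

`low1214X_holds : Low1214X c′` — no manuscript claim enters as a hypothesis. Route: the §8 evaluation
rule `lamAvg_rule` (`Section10cLamAvgRule`, unconditional) applied DIRECTLY on the window `[1, P^{0.496}]`
to the profile `G(t) = ῑ₃𝔣_{j6}(P^{0.498}/t)/0.498 + ῑ₄𝔣_{j7}(P^{0.5}/t)/0.5` (`lowG1214_bounds`:
`‖G‖ ≤ 29K_ι`, `‖G′(t)‖ ≤ 94K_ια/t`, `K_ι = ‖ῑ₃/0.498‖ + ‖ῑ₄/0.5‖`, from sz-d29's
`Section8AbelProfiles.frakfW_div_bounds`) — the target IS the `x`-integral, so no `P^z` comparison is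
needed; `𝔞 = c_D·L′(1,χ)²` (`frakA_eq_cD_mul`) identifies `lowX1214 = K·c_D∫₁^{P^{0.496}}G(t)dt/t`
with the prefactor `K = L′(1,χ)²β_{j+1}β_{j+2}/500` of `lowSum1214 = K·lamAvg(G)`, `‖K‖ ≤ 0.512e⁹𝓛⁴α²`
(`|L′(1,χ)| ≤ 4e^{9/2}𝓛²`, `|β_k| ≤ 4α`); total error `≤ 0.512e⁹π²C₀M_tot·𝓛⁻¹² ≤ εα` once
`𝓛 ≥ 0.512e⁹πC₀M_tot/ε + 1`.

## References

* Y. Zhang, arXiv:2211.02515v1 (2022), §10 p. 60; §8 p. 48; §2 (2.13), (2.26), (2.31).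
  [cite: Zhang2022LandauSiegel, §10 p. 60]
-/

noncomputable section

open Complex Real ComplexConjugate
open Literature.NumberTheory.LFunctions.Zhang2022.Skeleton

namespace Literature.NumberTheory.LFunctions.Zhang2022.Typed.Sec10C

section Low1214X

/-- **The low-range profile of `S_j(𝐚₁₂,𝐚₁₄)` as a function of a real variable**, in the
`const · profile` arrangement: `G(t) = (ῑ₃/0.498)𝔣_{j6}(P^{0.498}/t) + (ῑ₄/0.5)𝔣_{j7}(P^{0.5}/t)`, with its
bounds on `[1, P]`: differentiable, `‖G‖ ≤ 29(‖ῑ₃/0.498‖ + ‖ῑ₄/0.5‖)`, `‖G′(t)‖ ≤ 94(‖ῑ₃/0.498‖ + ‖ῑ₄/0.5‖)α/t`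
(`Section8AbelProfiles.frakfW_div_bounds`). [cite: Zhang2022LandauSiegel, §10 p. 60] -/
theorem lowG1214_bounds (c' : ℝ) {D : ℕ} (j : ℕ) (hα : 0 < alpha D) (hℓ : 0 ≤ ell D)
    (hc : 5 * |c'| * alpha D * ell D ≤ 1) (h498P : bigP D ^ (0.498 : ℝ) ≤ bigP D)
    (h498 : 1 ≤ bigP D ^ (0.498 : ℝ)) (h5P : bigP D ^ (0.5 : ℝ) ≤ bigP D)
    (h5 : 1 ≤ bigP D ^ (0.5 : ℝ)) {t : ℝ} (ht1 : 1 ≤ t) (htP : t ≤ bigP D) :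
    DifferentiableAt ℝ (fun u : ℝ =>
        conj iota3 / 0.498 * frakfW c' D j 6 (bigP D ^ (0.498 : ℝ) / u) +
          conj iota4 / 0.5 * frakfW c' D j 7 (bigP D ^ (0.5 : ℝ) / u)) t ∧
      ‖conj iota3 / 0.498 * frakfW c' D j 6 (bigP D ^ (0.498 : ℝ) / t) +
          conj iota4 / 0.5 * frakfW c' D j 7 (bigP D ^ (0.5 : ℝ) / t)‖ ≤
        ‖conj iota3 / (0.498 : ℂ)‖ * 29 + ‖conj iota4 / (0.5 : ℂ)‖ * 29 ∧
      ‖deriv (fun u : ℝ =>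
        conj iota3 / 0.498 * frakfW c' D j 6 (bigP D ^ (0.498 : ℝ) / u) +
          conj iota4 / 0.5 * frakfW c' D j 7 (bigP D ^ (0.5 : ℝ) / u)) t‖ ≤
        (‖conj iota3 / (0.498 : ℂ)‖ * (94 * alpha D) + ‖conj iota4 / (0.5 : ℂ)‖ * (94 * alpha D)) / t := by
  have hαΛ : alpha D * Real.log (bigP D) ≤ 4 := by
    have : alpha D * Real.log (bigP D) = π := by
      rw [alpha]; field_simp [(show Real.log (bigP D) ≠ 0 from by
        intro h; rw [alpha, h, div_zero] at hα; exact lt_irrefl _ hα)]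
    rw [this]; linarith [Real.pi_lt_four]
  obtain ⟨d6, n6, n6'⟩ := Section8AbelProfiles.frakfW_div_bounds c' j 6 hα hℓ hc h498 h498P ht1 htP hαΛ
  obtain ⟨d7, n7, n7'⟩ := Section8AbelProfiles.frakfW_div_bounds c' j 7 hα hℓ hc h5 h5P ht1 htP hαΛ
  obtain ⟨e6, m6, m6'⟩ := const_mul_bounds (conj iota3 / (0.498 : ℂ)) d6 n6 n6'
  obtain ⟨e7, m7, m7'⟩ := const_mul_bounds (conj iota4 / (0.5 : ℂ)) d7 n7 n7'
  have m6'' : ‖deriv (fun u : ℝ => conj iota3 / 0.498 * frakfW c' D j 6 (bigP D ^ (0.498 : ℝ) / u)) t‖ ≤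
      ‖conj iota3 / (0.498 : ℂ)‖ * (94 * alpha D) / t := by simpa [mul_div_assoc] using m6'
  have m7'' : ‖deriv (fun u : ℝ => conj iota4 / 0.5 * frakfW c' D j 7 (bigP D ^ (0.5 : ℝ) / u)) t‖ ≤
      ‖conj iota4 / (0.5 : ℂ)‖ * (94 * alpha D) / t := by simpa [mul_div_assoc] using m7'
  exact add_bounds e6 e7 m6 m7 m6'' m7''

/-- The prefactor of `lowSum1214`: `‖L′(1,χ)²β_{j+1}β_{j+2}/500‖ ≤ 0.512e⁹𝓛⁴α²`
(`|L′(1,χ)| ≤ 4e^{9/2}𝓛²`, `|β_k| ≤ 4α`). [cite: Zhang2022LandauSiegel, §10 p. 60] -/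
theorem norm_KLow1214_le (c' : ℝ) {D : ℕ} [NeZero D] (χ : DirichletCharacter ℂ D) (hℓ3 : 3 ≤ ell D)
    (hp : χ.IsPrimitive) (hα : 0 < alpha D) (hc : 5 * |c'| * alpha D * ell D ≤ 1) (j : ℕ) :
    ‖deriv χ.LFunction 1 ^ 2 / 500 * (betaJ c' D (j + 1) * betaJ c' D (j + 2))‖ ≤
      0.512 * Real.exp 9 * ell D ^ 4 * alpha D ^ 2 := by
  have hℓ0 : 0 ≤ ell D := by linarith
  have hL : ‖deriv χ.LFunction 1‖ ≤ 4 * Real.exp (9 / 2) * ell D ^ 2 := by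
    have hlog : 3 ≤ Real.log D := by simpa only [ell] using hℓ3
    have hw : ‖(1 : ℂ) - 1‖ ≤ 1 / Real.log D := by
      rw [sub_self, norm_zero]; exact div_nonneg zero_le_one (by linarith)
    have h := Lemma31.norm_deriv_LFunction_le_near_one χ hlog hp hw
    have h1 : (1 + ell D) * ell D ≤ 2 * ell D ^ 2 := by nlinarith
    calc ‖deriv χ.LFunction 1‖ ≤ 2 * Real.exp (9 / 2) * (1 + ell D) * ell D := h
      _ = 2 * Real.exp (9 / 2) * ((1 + ell D) * ell D) := by ring
      _ ≤ 2 * Real.exp (9 / 2) * (2 * ell D ^ 2) := by gcongr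
      _ = 4 * Real.exp (9 / 2) * ell D ^ 2 := by ring
  have hβ1 := Section8AbelProfiles.norm_betaJ_le c' hα.le hℓ0 hc (j + 1)
  have hβ2 := Section8AbelProfiles.norm_betaJ_le c' hα.le hℓ0 hc (j + 2)
  rw [norm_mul, norm_div, norm_pow, norm_mul]
  have h500 : ‖(500 : ℂ)‖ = 500 := by norm_num
  rw [h500]
  have hL2 : ‖deriv χ.LFunction 1‖ ^ 2 ≤ (4 * Real.exp (9 / 2) * ell D ^ 2) ^ 2 :=
    pow_le_pow_left₀ (norm_nonneg _) hL 2
  have he : Real.exp (9 / 2) ^ 2 = Real.exp 9 := by rw [← Real.exp_nat_mul]; norm_num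
  calc ‖deriv χ.LFunction 1‖ ^ 2 / 500 * (‖betaJ c' D (j + 1)‖ * ‖betaJ c' D (j + 2)‖)
      ≤ (4 * Real.exp (9 / 2) * ell D ^ 2) ^ 2 / 500 * ((4 * alpha D) * (4 * alpha D)) := by
        gcongr
    _ = 0.512 * Real.exp 9 * ell D ^ 4 * alpha D ^ 2 := by rw [← he]; ring

/-- `lowX1214` over the prefactor of `lowSum1214`: with `𝔞 = c_D L′(1,χ)²`,
`(𝔞β_{j+1}β_{j+2}/500)∫ = (L′²β_{j+1}β_{j+2}/500)·c_D·∫`. [cite: Zhang2022LandauSiegel, §10 p. 60] -/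
theorem lowX1214_eq_cD (c' : ℝ) {D : ℕ} [NeZero D] (χ : DirichletCharacter ℂ D) (hD2 : 2 ≤ D)
    (hq : χ.IsQuadratic) (hp : χ.IsPrimitive) (j : ℕ) :
    lowX1214 c' χ j = deriv χ.LFunction 1 ^ 2 / 500 * (betaJ c' D (j + 1) * betaJ c' D (j + 2)) *
      ((((6 / π ^ 2 * ∏ q ∈ D.primeFactors, ((q : ℝ) / (q + 1)) : ℝ)) : ℂ) *
        ∫ x in (1 : ℝ)..bigP D ^ (0.496 : ℝ),
          (conj iota3 / 0.498 * frakfW c' D j 6 (bigP D ^ (0.498 : ℝ) / x) +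
              conj iota4 / 0.5 * frakfW c' D j 7 (bigP D ^ (0.5 : ℝ) / x)) / (x : ℂ)) := by
  rw [lowX1214, frakA_eq_cD_mul χ hD2 hq hp]
  have e : (fun x : ℝ => (conj iota3 * frakfW c' D j 6 (bigP D ^ (0.498 : ℝ) / x) / 0.498 +
      conj iota4 * frakfW c' D j 7 (bigP D ^ (0.5 : ℝ) / x) / 0.5) / (x : ℂ)) =
      fun x : ℝ => (conj iota3 / 0.498 * frakfW c' D j 6 (bigP D ^ (0.498 : ℝ) / x) +
        conj iota4 / 0.5 * frakfW c' D j 7 (bigP D ^ (0.5 : ℝ) / x)) / (x : ℂ) := by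
    funext x; ring
  rw [e]
  ring

/-- `lowSum1214` over the profile of `lowG1214_bounds` (same summands, rearranged `ῑ𝔣/θ = (ῑ/θ)𝔣`).
[cite: Zhang2022LandauSiegel, §10 p. 60] -/
theorem lowSum1214_eq (c' : ℝ) {D : ℕ} [NeZero D] (χ : DirichletCharacter ℂ D) (j : ℕ) :
    lowSum1214 c' χ j = deriv χ.LFunction 1 ^ 2 / 500 * (betaJ c' D (j + 1) * betaJ c' D (j + 2)) *
      lamAvg c' χ j 1 (bigP D ^ (0.496 : ℝ)) (fun n =>
        conj iota3 / 0.498 * frakfW c' D j 6 (bigP D ^ (0.498 : ℝ) / n) +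
          conj iota4 / 0.5 * frakfW c' D j 7 (bigP D ^ (0.5 : ℝ) / n)) := by
  rw [lowSum1214]
  congr 1
  unfold lamAvg
  exact Finset.sum_congr rfl fun n _ => by ring

/-- Arithmetic of the final `o(α)` bound of `low1214X_holds`. [folklore] -/
private theorem arith_low {ℓ ε C₀ Mtot nK nA K₀ : ℝ} (hℓ : 1 ≤ ℓ) (hε : 0 < ε) (hC₀ : 0 ≤ C₀)
    (hMtot : 0 ≤ Mtot) (hnA0 : 0 ≤ nA) (hK₀ : 0 ≤ K₀)
    (hnK : nK ≤ K₀ * ℓ ^ 4 * (π / ℓ ^ 9) ^ 2) (hnA : nA ≤ C₀ * ℓ ^ 2 * Mtot)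
    (hbig : K₀ * π * C₀ * Mtot / ε + 1 ≤ ℓ) :
    nK * nA ≤ ε * (π / ℓ ^ 9) := by
  have hℓ0 : 0 < ℓ := by linarith
  set X : ℝ := K₀ * π * C₀ * Mtot with hX
  have hX0 : 0 ≤ X := by positivity
  have h1 : nK * nA ≤ (K₀ * ℓ ^ 4 * (π / ℓ ^ 9) ^ 2) * (C₀ * ℓ ^ 2 * Mtot) :=
    mul_le_mul hnK hnA hnA0 (by positivity)
  have h2 : (K₀ * ℓ ^ 4 * (π / ℓ ^ 9) ^ 2) * (C₀ * ℓ ^ 2 * Mtot) = (X / ℓ ^ 3) * (π / ℓ ^ 9) := by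
    rw [hX]; field_simp
  rw [h2] at h1
  refine h1.trans (mul_le_mul_of_nonneg_right ?_ (by positivity))
  rw [div_le_iff₀ (by positivity)]
  have h3 : X / ε ≤ ℓ - 1 := by linarith
  rw [div_le_iff₀ hε] at h3
  have h4 : ℓ ≤ ℓ ^ 3 := by nlinarith
  nlinarith

/-- **Z22:§10.u055 (ii) holds** [Z22 p.60, tex L3081, second line]: `Low1214X c′` —
"`… = (𝔞β_{j+1}β_{j+2}/500)∫₁^{P^{0.496}}(ῑ₃𝔣_{j6}(P^{0.498}/x)/0.498 + ῑ₄𝔣_{j7}(P^{0.5}/x)/0.5)dx/x + o(α)`"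
for the arithmetic form `lowSum1214` of the low range of `S_j(𝐚₁₂,𝐚₁₄)`. PROVED OUTRIGHT (no manuscript
claim as hypothesis): the §8 evaluation rule (`lamAvg_rule`: `λ₀ⱼ(n) = φ(n)²/n²(1 + O(α𝓛))` and
`Σ_{n<x}|χ(n)|φ(n)/n² = c_D log x + O(𝓛²)` + partial summation) on `[1, P^{0.496}]` with the `O(1)`,
`O(α/t)` profile bounds of Lemma 8.2's `𝔣_{jμ}`, and `c_D·L′(1,χ)² = 𝔞`; the total error is
`≪_{c′} 𝓛⁴α²·𝓛² = O(𝓛⁻¹²) = o(α)`. [cite: Zhang2022LandauSiegel, §10 p. 60] -/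
theorem low1214X_holds (c' : ℝ) : Low1214X c' := by
  intro ε hε
  obtain ⟨C₀, hC₀, hrule⟩ := lamAvg_rule c'
  -- the constants
  obtain ⟨Kι, hKι⟩ : ∃ Kι : ℝ, Kι = ‖conj iota3 / (0.498 : ℂ)‖ + ‖conj iota4 / (0.5 : ℂ)‖ := ⟨_, rfl⟩
  obtain ⟨Mtot, hMtot⟩ : ∃ Mtot : ℝ, Mtot = 29 * Kι + 94 * Kι * π := ⟨_, rfl⟩
  obtain ⟨K₀, hK₀⟩ : ∃ K₀ : ℝ, K₀ = 0.512 * Real.exp 9 := ⟨_, rfl⟩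
  obtain ⟨Ctot, hCtot⟩ : ∃ Ctot : ℝ, Ctot = K₀ * π * C₀ * Mtot := ⟨_, rfl⟩
  have hKι0 : 0 ≤ Kι := by rw [hKι]; positivity
  have hMtot0 : 0 ≤ Mtot := by rw [hMtot]; positivity
  have hK₀0 : 0 ≤ K₀ := by rw [hK₀]; positivity
  have hCtot0 : 0 ≤ Ctot := by rw [hCtot]; positivity
  have hbig : ForAllLarge fun D _ _ => Ctot / ε + 1 ≤ ell D := by
    refine ⟨⌈Real.exp (Ctot / ε + 1)⌉₊, fun D _ χ hD _ _ => ?_⟩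
    have hexp : Real.exp (Ctot / ε + 1) ≤ D := le_trans (Nat.le_ceil _) (by exact_mod_cast hD)
    show Ctot / ε + 1 ≤ Real.log D
    exact (Real.le_log_iff_exp_le (lt_of_lt_of_le (Real.exp_pos _) hexp)).mpr hexp
  refine ((hrule.and (forAllLarge_five_c c')).and hbig).mono ?_
  intro D _ χ hq hp ⟨⟨hR, hD3, hℓ6, hc5⟩, hℓbig⟩ _ j _
  -- parameters
  have hD2 : 2 ≤ D := by omega
  have hℓ3 : 3 ≤ ell D := by linarith
  have hℓ1 : 1 ≤ ell D := by linarith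
  have hℓ0 : 0 < ell D := by linarith
  have hΛ : Real.log (bigP D) = ell D ^ 9 := by rw [bigP, Real.log_exp]
  have hΛpos : 0 < Real.log (bigP D) := by rw [hΛ]; positivity
  have hα : 0 < alpha D := alpha_pos hΛpos
  have hαΛ : alpha D * Real.log (bigP D) = π := by rw [alpha, div_mul_cancel₀ _ hΛpos.ne']
  have hαeq : alpha D = π / ell D ^ 9 := by rw [alpha, hΛ]
  have hP0 : 0 < bigP D := Real.exp_pos _
  have hP1 : 1 ≤ bigP D := one_le_bigP D
  have h496 : 1 ≤ bigP D ^ (0.496 : ℝ) := Real.one_le_rpow hP1 (by norm_num)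
  have h498 : 1 ≤ bigP D ^ (0.498 : ℝ) := Real.one_le_rpow hP1 (by norm_num)
  have hhi1 : 1 ≤ bigP D ^ (0.5 : ℝ) := Real.one_le_rpow hP1 (by norm_num)
  have h496_5 : bigP D ^ (0.496 : ℝ) ≤ bigP D ^ (0.5 : ℝ) :=
    Real.rpow_le_rpow_of_exponent_le hP1 (by norm_num)
  have h498_5 : bigP D ^ (0.498 : ℝ) ≤ bigP D ^ (0.5 : ℝ) :=
    Real.rpow_le_rpow_of_exponent_le hP1 (by norm_num)
  have hhiP5 : bigP D ^ (0.5 : ℝ) + 1 ≤ bigP D := by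
    -- `√P + 1 ≤ P` since `√P ≥ 2` (`P = e^{𝓛⁹} ≥ e^{6⁹}`)
    have hsq : bigP D ^ (0.5 : ℝ) * bigP D ^ (0.5 : ℝ) = bigP D := by
      rw [← Real.rpow_add hP0]; norm_num
    have h2 : 2 ≤ bigP D ^ (0.5 : ℝ) := by
      have h4 : (4 : ℝ) ≤ bigP D := by
        rw [bigP]
        have : (4 : ℝ) ≤ Real.exp 2 := by
          have h1 := Real.exp_one_gt_d9
          have h2 : Real.exp 2 = Real.exp 1 * Real.exp 1 := by rw [← Real.exp_add]; norm_num
          rw [h2]; nlinarith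
        refine this.trans (Real.exp_le_exp.mpr ?_)
        calc (2 : ℝ) ≤ 6 ^ 9 := by norm_num
          _ ≤ ell D ^ 9 := pow_le_pow_left₀ (by norm_num) hℓ6 9
      nlinarith [Real.rpow_nonneg hP0.le (0.5 : ℝ)]
    nlinarith [Real.rpow_nonneg hP0.le (0.5 : ℝ)]
  have hhiP : bigP D ^ (0.496 : ℝ) + 1 ≤ bigP D := by linarith
  have h5P : bigP D ^ (0.5 : ℝ) ≤ bigP D := by linarith
  have h498P : bigP D ^ (0.498 : ℝ) ≤ bigP D := by linarith
  -- the profile and its bounds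
  obtain ⟨G, hGdef⟩ : ∃ G : ℝ → ℂ, G = fun u =>
      conj iota3 / 0.498 * frakfW c' D j 6 (bigP D ^ (0.498 : ℝ) / u) +
        conj iota4 / 0.5 * frakfW c' D j 7 (bigP D ^ (0.5 : ℝ) / u) := ⟨_, rfl⟩
  obtain ⟨M, hM⟩ : ∃ M : ℝ, M = ‖conj iota3 / (0.498 : ℂ)‖ * 29 + ‖conj iota4 / (0.5 : ℂ)‖ * 29 :=
    ⟨_, rfl⟩
  obtain ⟨M', hM'⟩ : ∃ M' : ℝ,
      M' = ‖conj iota3 / (0.498 : ℂ)‖ * (94 * alpha D) + ‖conj iota4 / (0.5 : ℂ)‖ * (94 * alpha D) :=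
    ⟨_, rfl⟩
  have hM0 : 0 ≤ M := by rw [hM]; positivity
  have hGb : ∀ t, (1 : ℝ) ≤ t → t ≤ bigP D ^ (0.496 : ℝ) + 1 →
      DifferentiableAt ℝ G t ∧ ‖G t‖ ≤ M ∧ ‖deriv G t‖ ≤ M' / t := by
    intro t h1 h2
    rw [hGdef, hM, hM']
    exact lowG1214_bounds c' j hα hℓ0.le hc5 h498P h498 h5P hhi1 h1 (le_trans h2 hhiP)
  have hA := hR j _ _ M M' G le_rfl h496 hhiP hM0 hGb
  have hMM : M + M' * Real.log (bigP D) = Mtot := by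
    rw [hMtot, hM', hM, hKι, ← hαΛ]; ring
  rw [hMM] at hA
  -- the constants `K` and `𝔞 = c_D L′²`
  obtain ⟨cD, hcD⟩ : ∃ cD : ℝ, cD = 6 / π ^ 2 * ∏ q ∈ D.primeFactors, ((q : ℝ) / (q + 1)) :=
    ⟨_, rfl⟩
  rw [← hcD] at hA
  obtain ⟨K, hK⟩ : ∃ K : ℂ, K = deriv χ.LFunction 1 ^ 2 / 500 * (betaJ c' D (j + 1) * betaJ c' D (j + 2)) :=
    ⟨_, rfl⟩
  have hKn : ‖K‖ ≤ K₀ * ell D ^ 4 * (π / ell D ^ 9) ^ 2 := by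
    rw [hK, hK₀, ← hαeq]; exact norm_KLow1214_le c' χ hℓ3 hp hα hc5 j
  -- `lowSum = K·lamAvg(G)`, `lowX = K·c_D·∫G/t`
  have hSum : lowSum1214 c' χ j = K * lamAvg c' χ j 1 (bigP D ^ (0.496 : ℝ)) (fun n => G n) := by
    rw [hK, hGdef]; exact lowSum1214_eq c' χ j
  have hX : lowX1214 c' χ j = K * ((cD : ℂ) * ∫ t in (1 : ℝ)..bigP D ^ (0.496 : ℝ), G t / t) := by
    rw [hK, hcD, hGdef]; exact lowX1214_eq_cD c' χ hD2 hq hp j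
  -- assemble
  rw [hSum, hX, ← mul_sub, norm_mul]
  rw [hCtot] at hℓbig
  have hfin := arith_low (nK := ‖K‖) hℓ1 hε hC₀ hMtot0 (norm_nonneg _) hK₀0 hKn hA hℓbig
  rw [hαeq]
  exact hfin

variable (c' : ℝ) in
/-- `Low1214X` — `_holds` alias of `low1214X_holds` above under the fact's exact name, stated under the
prover's own binders as section variables (appended 2026-08-28, D-0026 bookkeeping: the proof term is the
existing theorem of this file; no statement, definition or attribute is edited; no new named fact; the
ledger's debt table listed the fact unproved). [cite: Zhang2022LandauSiegel, §10 p. 60] -/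
theorem _root_.Literature.NumberTheory.LFunctions.Zhang2022.Typed.Sec10C.Low1214X_holds :
    _root_.Literature.NumberTheory.LFunctions.Zhang2022.Typed.Sec10C.Low1214X c' :=
  _root_.Literature.NumberTheory.LFunctions.Zhang2022.Typed.Sec10C.low1214X_holds (c' := c')

end Low1214X

end Literature.NumberTheory.LFunctions.Zhang2022.Typed.Sec10C
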